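import Mathlib
import HarnessLib
import Summits.Ventures.LatticeQCDFlow.Exactness.InvolutiveMetropolis
import Summits.Ventures.LatticeQCDFlow.Exactness.FlowPushforward

/-!
# PTBC (parallel tempering on boundary conditions): the replica swap and the translation move are exact

HONEST FRAMING: exact (Metropolis-corrected) sampling algorithms for lattice gauge theory;
figures of merit are autocorrelation/cost numbers at stated couplings and volumes; no
continuum-physics claim.

Venture `LatticeQCDFlow` (cell pub-lqcd), topic `Exactness`; written by FANOUT row 22 (su3-ptbc)
as the kernel-checked anchor of the exactness clause of its acceptance card (HOME
`su3-ptbc/CARD-su3-ptbc.md` §1 item 4).  NEW WORK of the cell — two corollaries of the cell's own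
`InvolutiveMetropolis.lean` (E5, T-REX swap) and `FlowPushforward.lean`; nothing here is cited as
a fact.  Printed counterparts, named only: Hasenbusch, PRD 96 (2017) 054504 (tempering in the
boundary coupling of a defect, swap Metropolis step, translation of the periodic copy);
Bonanno–Bonati–D'Elia, JHEP 03 (2021) 111 (the 4D SU(N) version; swap probability
`min {1, e^{−ΔS}}`, `ΔS = S^{(r)}[U_s] + S^{(s)}[U_r] − S^{(r)}[U_r] − S^{(s)}[U_s]`).

## Content (reference measure `vol` on a measurable space `Ω` = one replica's configurations)

* `ptbcSwap_isReversible`, `ptbcSwap_invariant` — two replicas with ARBITRARY measurable actions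
  `S₁`, `S₂` on the same space (in PTBC: the Wilson action with the defect plaquettes weighted by
  `c(r)` resp. `c(s)`; the statement does not care): the swap `(x, y) ↦ (y, x)` accepted with
  `min {1, exp (S₁ x + S₂ y − S₁ y − S₂ x)}` is reversible for, and leaves invariant, the product
  Boltzmann measure `e^{−S₁(x) − S₂(y)} vol ⊗ vol`.  This is the `f = id` case of
  `trex_isReversible`.  `involAccept_ptbcSwap` records that the acceptance is `min {1, e^{−ΔS}}`
  with the printed `ΔS`.
* `measurePreserving_withDensity_of_actionInvariant` — a `vol`-preserving measurable bijection `T`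
  with `S ∘ T = S` preserves `e^{−S} vol`: the deterministic translation of the periodic replica
  (acceptance one) is exact because the periodic action is translation invariant.

Not here: the composition of a whole PTBC cycle (each factor leaves the product measure invariant,
hence so does the composite — `ProbabilityTheory.Kernel.Invariant.comp`), the local heat-bath /
over-relaxation factors, ergodicity, and every quantitative statement (swap-acceptance and
autocorrelation laws are printed MEASUREMENTS, pre-registered in the card, not theorems).
-/

namespace Summit.Ventures.LatticeQCDFlow.Exactness

open MeasureTheory ProbabilityTheory
open scoped ENNReal

variable {Ω : Type*} [MeasurableSpace Ω]

/-- The plain replica swap is the T-REX move through the identity bijection: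
`trexSwap (refl Ω) (x, y) = (y, x)`. -/
theorem trexSwap_refl_apply (z : Ω × Ω) : trexSwap (MeasurableEquiv.refl Ω) z = z.swap := rfl

/-- The PTBC swap acceptance at `(x, y)` is `min {1, e^{−ΔS}}` with the printed
`ΔS = S₁ y + S₂ x − S₁ x − S₂ y` (replica 1 would receive `y`, replica 2 would receive `x`). -/
theorem involAccept_ptbcSwap (S₁ S₂ : Ω → ℝ) (x y : Ω) :
    involAccept (fun z : Ω × Ω => S₁ z.1 + S₂ z.2) (trexSwap (MeasurableEquiv.refl Ω)) (x, y)
      = min 1 (Real.exp (-(S₁ y + S₂ x - S₁ x - S₂ y))) := by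
  simp only [involAccept, trexSwap_refl_apply, Prod.swap_prod_mk]
  congr 1
  ring_nf

/-- **PTBC swap — exact for every pair of boundary actions (reversibility).**  For measurable
`S₁ S₂ : Ω → ℝ`, the kernel "propose `(x, y) ↦ (y, x)`, accept with
`min {1, exp (S₁ x + S₂ y − S₁ y − S₂ x)}`, else stay" is reversible with respect to
`e^{−(S₁ x + S₂ y)} (vol ⊗ vol)`. -/
theorem ptbcSwap_isReversible {vol : Measure Ω} [SFinite vol] {S₁ S₂ : Ω → ℝ}
    (hS₁ : Measurable S₁) (hS₂ : Measurable S₂) :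
    Kernel.IsReversible
      (involMH (trexSwap (MeasurableEquiv.refl Ω)) (measurable_trexSwap _) fun z => S₁ z.1 + S₂ z.2)
      ((vol.prod vol).withDensity fun z => ENNReal.ofReal (Real.exp (-(S₁ z.1 + S₂ z.2)))) :=
  trex_isReversible (MeasurableEquiv.refl Ω) hS₁ hS₂ (MeasurePreserving.id vol)

/-- **PTBC swap — invariance.**  The product Boltzmann measure `e^{−(S₁ x + S₂ y)} (vol ⊗ vol)` is
invariant under the PTBC swap kernel, for every pair of measurable actions. -/
theorem ptbcSwap_invariant {vol : Measure Ω} [SFinite vol] {S₁ S₂ : Ω → ℝ}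
    (hS₁ : Measurable S₁) (hS₂ : Measurable S₂) :
    Kernel.Invariant
      (involMH (trexSwap (MeasurableEquiv.refl Ω)) (measurable_trexSwap _) fun z => S₁ z.1 + S₂ z.2)
      ((vol.prod vol).withDensity fun z => ENNReal.ofReal (Real.exp (-(S₁ z.1 + S₂ z.2)))) := by
  haveI : Fact (Measurable fun z : Ω × Ω => S₁ z.1 + S₂ z.2) :=
    ⟨(hS₁.comp measurable_fst).add (hS₂.comp measurable_snd)⟩
  exact (ptbcSwap_isReversible hS₁ hS₂).invariant

/-- **Translation move — exact.**  If the measurable bijection `T` preserves the reference measure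
`vol` and the action (`S (T x) = S x` for all `x`), then `T` preserves the Boltzmann measure
`e^{−S} vol`; in PTBC, `T` = a lattice translation applied to the PERIODIC replica only, whose
action has no defect and is translation invariant. -/
theorem measurePreserving_withDensity_of_actionInvariant {vol : Measure Ω} (T : Ω ≃ᵐ Ω)
    (hT : MeasurePreserving T vol vol) {S : Ω → ℝ} (hS : Measurable S)
    (hinv : ∀ x, S (T x) = S x) :
    MeasurePreserving T (vol.withDensity fun x => ENNReal.ofReal (Real.exp (-S x)))
      (vol.withDensity fun x => ENNReal.ofReal (Real.exp (-S x))) := by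
  refine ⟨T.measurable, ?_⟩
  have hg : Measurable fun x => ENNReal.ofReal (Real.exp (-S x)) :=
    (Real.measurable_exp.comp hS.neg).ennreal_ofReal
  have hd : (fun x => ENNReal.ofReal (Real.exp (-S x)))
      = fun x => ENNReal.ofReal (Real.exp (-S (T x))) := by
    funext x
    rw [hinv x]
  calc Measure.map T (vol.withDensity fun x => ENNReal.ofReal (Real.exp (-S x)))
      = Measure.map T (vol.withDensity fun x => ENNReal.ofReal (Real.exp (-S (T x)))) := by
        rw [← hd]
    _ = (Measure.map T vol).withDensity fun x => ENNReal.ofReal (Real.exp (-S x)) :=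
        map_withDensity_comp_eq (g := fun x => ENNReal.ofReal (Real.exp (-S x))) T.measurable hg
    _ = vol.withDensity fun x => ENNReal.ofReal (Real.exp (-S x)) := by
        rw [hT.map_eq]

end Summit.Ventures.LatticeQCDFlow.Exactness
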